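import Literature.NumberTheory.Automorphic.IsAutomorphicAE
import Literature.NumberTheory.Automorphic.AdicCompletionLocalField
import Literature.NumberTheory.GaloisRepresentations.LabelledHodgeTateWeights
import Literature.NumberTheory.GaloisRepresentations.CrystallineDeformationRing
import Literature.NumberTheory.PAdicHodge.FontaineDpst
import HarnessLib

/-!
# Modularity of two-dimensional crystalline representations of a totally real field at a
# totally split prime (Kisin 2009; Paškūnas 2015; Hu–Tan 2015, Thm. 6.3)

Topic `Literature/NumberTheory/Automorphic` (companion of `ReciprocityGLn` — whose lang.S03
`FontaineMazurLanglandsGLn` is the general conjecture of which this is a PROVED case — and of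
`IsAutomorphicAE`, whose `SatakeFrobCompatibleAE ι π ρ` renders "`ρ` arises from `π`").
One NAMED FACT (D-0014), `HuTan2015_theorem63`.

## The printed theorems

* M. Kisin, *The Fontaine–Mazur conjecture for `GL₂`*, J. Amer. Math. Soc. 22 (2009) 641–690
  [Kisin2009] (held: `paper:doi-10-1090-s0894-0347-09-00628-6`), **Theorem (2.2.18)** (p. 685):
  "Let `F` be a totally real field where `p` is totally split, and let `ρ : G_{F,S} → GL₂(𝒪)` be a
  continuous representation.  Suppose that (1) For `v ∣ p`, `ρ|_{G_{F_v}}` becomes semi-stable over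
  an abelian extension of `F_v` and has distinct Hodge–Tate weights. (2) `ρ̄ : G_{F,S} → GL₂(𝔽)` is
  modular and `ρ̄|_{F(ζ_p)}` is absolutely irreducible. (3) For `v ∣ p`, `ρ̄|_{G_{F_v}} ≁ (ωχ *; 0 χ)`
  for any character `χ`.  Then `ρ` is modular." (`p > 2`; Introduction, p. 642: "we prove the
  theorem … where `ℚ` is replaced by any totally real field in which `p` splits completely".)
* V. Paškūnas, *On the Breuil–Mézard conjecture*, Duke Math. J. 164 (2015) [Paskunas2015] and
  Y. Hu, F. Tan, *The Breuil–Mézard conjecture for non-scalar split residual representations*,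
  Ann. Sci. ÉNS 48 (2015) 1383–1421 [HuTan2015] (held: arXiv:1309.1658) remove the local
  restriction (3) for `p ≥ 5` (Hu–Tan, Abstract: "Combined with the cases previously proved in
  [Kisin] and [Paškūnas], this completes the proof of the [Breuil–Mézard] conjecture (when `p ≥ 5`).
  As a consequence, the local restriction in the proof of the Fontaine–Mazur conjecture in [Kisin]
  is removed"), giving **Hu–Tan, Theorem 6.3** (standing assumption `p ≥ 5`): "Let `F` be a totally
  real field in which `p` splits. Let `ρ : G_{F,S} → GL₂(𝒪)` be a continuous representation such
  that `ρ̄` is odd, `ρ̄|_{G_{F(ζ_p)}}` is absolutely irreducible, the restriction `ρ|_{G_{F_v}}` for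
  each place `v ∣ p` is potentially semi-stable of distinct Hodge–Tate weights, and the residual
  representation `ρ̄` is modular.  Then `ρ` comes from a Hilbert modular form."

## Rendering in the tree's vocabulary (read before reviewing)

* "`p` splits (completely)": `p ∤ d_F` (unramified; Dedekind) and every `v ∣ p` has residue
  field of order `p` — the hypothesis of the route statements of `Langlands/WachComponentCensus`.
* `ρ : G_{F,S} → GL₂(𝒪)`: a continuous `ρ : Γ_F → GL₂(ℚ̄_p)` (`FramedGaloisRep`) unramified at
  all but finitely many places; such a `ρ` lands in `GL₂(E)`, `E/ℚ_p` finite (compactness and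
  Baire; Skinner 2009 §2, the tree's PROVED `exists_hasQlModel_holds`) and stabilises an
  `𝒪_E`-lattice, so this is the printed setting.
* "`ρ̄` odd" = `ρ` odd (`p > 2`): `FramedGaloisRep.IsOdd` (`det ρ(c) = -1` for every complex
  conjugation `c` — totally odd).
* "`ρ̄|_{G_{F(ζ_p)}}` absolutely irreducible" is rendered WITHOUT choosing a lattice, through the
  trace: there are NO continuous characters `χ₁, χ₂ : Γ_{F(ζ_p)} → ℚ̄_p^×` of finite order (open
  kernel) with `|tr ρ(σ) - χ₁(σ) - χ₂(σ)|_p < 1` for all `σ ∈ Γ_{F(ζ_p)}`.  (If `ρ̄|_{Γ_{F(ζ_p)}}`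
  were absolutely reducible, the Teichmüller lifts of the two characters of its
  semisimplification would be such `χ_i`; conversely such `χ_i` give `tr ρ̄ = χ̄₁ + χ̄₂` on
  `Γ_{F(ζ_p)}`, whence `ρ̄^{ss}|_{Γ_{F(ζ_p)}} ≅ χ̄₁ ⊕ χ̄₂` by Brauer–Nesbitt, `p > 2`.)  This is the
  clause of the route statements (`LiftB2Unram`, …) verbatim.
* "potentially semistable of distinct Hodge–Tate weights at `v ∣ p`": stated here in the SPECIAL
  CASE the first consumer needs — `ρ|_{Γ_{F_v}}` CRYSTALLINE for Fontaine's pinned datum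
  (`(fontainePstAdicCompletion v p hv).IsCrystallineFramed`; crystalline representations are
  semistable over `F_v` itself, so Kisin's (1) and Hu–Tan's hypothesis both hold) with
  multiplicity-free labelled Hodge–Tate weights of cardinality `2` at every `ℚ_p`-embedding
  `τ : F_v → ℚ̄_p` (`labelledHodgeTateWeightsAt`, for the pinned datum's `ℚ_p`-structure and
  period ring).  -- TODO(general form): Hu–Tan prove it for potentially semistable `ρ|_{Γ_{F_v}}`.
* "`ρ̄` is modular": there are a cuspidal automorphic `π₀` of `GL₂(𝔸_F)`, `L`-algebraic with a
  regular infinity type (the representation `π₀ ⊗ |det|^{1/2}` of a cuspidal Hilbert eigenform of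
  weight `k_σ ≥ 2`; dictionary of `HilbertModularGaloisRep`), and a continuous `ρ₀` attached to
  `π₀` at almost all places (`SatakeFrobCompatibleAE`, so `ρ₀^{ss} ≅ ρ_{π₀,ι}`) with
  `|tr ρ(σ) - tr ρ₀(σ)|_p < 1` for all `σ`, i.e. `ρ̄^{ss} ≅ ρ̄_{π₀,ι}^{ss}`; as `ρ̄` is irreducible
  this is `ρ̄ ≅ ρ̄_{π₀,ι}` (any weight `≥ 2` and level: Kisin (2.2.18), proof, via Gee's
  prescribed-weight lifting).
* "`ρ` is modular / comes from a Hilbert modular form" (through the given `ι : ℚ̄_p ≃ ℂ`; Kisin's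
  `S_{σ,ψ}(U, 𝒪)` is intrinsic and is compared with automorphic representations through any `ι`):
  some cuspidal `π` of `GL₂(𝔸_F)`, `L`-algebraic with a regular infinity type, is attached to `ρ`
  at almost all places (`SatakeFrobCompatibleAE ι π.1 ρ`: arithmetic Frobenius with characteristic
  polynomial `∏ (X - ι⁻¹(α_j⁻¹))`, Buzzard–Gee's `L`-normalisation) — the conclusion of lang.S03
  (`IsAutomorphicAE`) plus regularity of `π_∞` (the eigenform has weight `k_σ ≥ 2`).
* `hcpt` (the named fact `isCompact_glFiniteIntegralLevel 2 F`) only types `π₀`, `π` (D-0014).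

## What is NOT here

`F = ℚ` needs no residual modularity (Khare–Wintenberger; Hu–Tan Thm. 1.4) — not restated;
`p ∈ {2, 3}` (Kisin, Tung 2021); potentially semistable non-crystalline `ρ` (TODO above);
residually reducible `ρ̄` (Skinner–Wiles, Pan 2022); `p` not totally split.

## References

* M. Kisin, J. Amer. Math. Soc. 22 (2009) 641–690, Thm. (2.2.18) and Introduction. [Kisin2009]
* V. Paškūnas, Duke Math. J. 164 (2015) 297–359, Thm. 1.1. [Paskunas2015]
* Y. Hu, F. Tan, Ann. Sci. ÉNS 48 (2015) 1383–1421, Thm. 6.3 (arXiv:1309.1658, §6). [HuTan2015]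
* K. Buzzard, T. Gee, LMS Lecture Note Ser. 414 (2014), Conj. 3.2.2. [BuzzardGeeLMS2014]
-/

noncomputable section

open scoped MatrixGroups Matrix NumberField
open NumberField IsDedekindDomain Field Filter

namespace Literature.NumberTheory.Automorphic

open Literature.NumberTheory.GaloisRepresentations

/-- **Hu–Tan 2015, Theorem 6.3 (with Kisin 2009, Thm. (2.2.18) and Paškūnas 2015): modularity of
two-dimensional `p`-adic representations of a totally real field at a totally split `p ≥ 5`**,
crystalline case (see the module docstring for the printed statements and the rendering).
Let `F` be a totally real number field and `p ≥ 5` a prime which splits completely in `F`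
(`p ∤ d_F` and every `v ∣ p` has residue field `𝔽_p`).  Let `ρ : Γ_F → GL₂(ℚ̄_p)` be continuous,
irreducible, unramified at all but finitely many places and (totally) odd, such that for every
`v ∣ p` the restriction `ρ|_{Γ_{F_v}}` is crystalline with two distinct Hodge–Tate weights
(Fontaine's pinned datum `fontainePstAdicCompletion`), such that `ρ̄|_{Γ_{F(ζ_p)}}` is absolutely
irreducible (trace rendering) and `ρ̄` is modular: `ρ̄^{ss} ≅ ρ̄₀^{ss}` for some `ρ₀` attached at
almost all places, through `ι : ℚ̄_p ≃ ℂ`, to a cuspidal automorphic representation `π₀` of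
`GL₂(𝔸_F)` that is `L`-algebraic with a regular infinity type.  Then `ρ` comes from a Hilbert
modular form: some cuspidal `π` of `GL₂(𝔸_F)`, `L`-algebraic with a regular infinity type, is
attached to `ρ` at almost all places (`SatakeFrobCompatibleAE ι π.1 ρ`, Buzzard–Gee's
`L`-normalisation).  Named fact (D-0014), `∀ hcpt`.
-- TODO(general form): potentially semistable (not only crystalline) `ρ|_{Γ_{F_v}}`, `v ∣ p`.
[cite: HuTan2015, Thm. 6.3] [cite: Kisin2009, Thm. (2.2.18)] [cite: Paskunas2015, Thm. 1.1] -/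
def HuTan2015_theorem63 : Prop :=
  ∀ (F : Type) [Field F] [NumberField F], IsTotallyReal F → ∀ (p : ℕ) [Fact p.Prime], 5 ≤ p →
    ¬ ((p : ℤ) ∣ NumberField.discr F) →
    (∀ v : HeightOneSpectrum (𝓞 F), ((p : ℕ) : 𝓞 F) ∈ v.asIdeal → v.residueCard = p) →
    ∀ (hcpt : isCompact_glFiniteIntegralLevel 2 F) (ι : PadicAlgCl p ≃+* ℂ)
      (ρ : FramedGaloisRep F (PadicAlgCl p) 2),
      ρ.toGaloisRep.IsIrreducible →
      (∀ᶠ v : HeightOneSpectrum (𝓞 F) in cofinite, ρ.IsUnramifiedAt v) →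
      ρ.IsOdd →
      (∀ (v : HeightOneSpectrum (𝓞 F)) (hv : ((p : ℕ) : 𝓞 F) ∈ v.asIdeal),
        let D := PAdicHodge.fontainePstAdicCompletion v p hv
        D.IsCrystallineFramed (ρ.toLocal v) ∧
        (letI := D.algebra
         ∀ τ : v.adicCompletion F →ₐ[ℚ_[p]] PadicAlgCl p,
          let M := ρ.labelledHodgeTateWeightsAt v D.algebra D.𝔅 τ.toRingHom
          M.Nodup ∧ Multiset.card M = 2)) →
      (¬ ∃ χ₁ χ₂ : absoluteGaloisGroup (CyclotomicField p F) →* (PadicAlgCl p)ˣ,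
          IsOpen (χ₁.ker : Set (absoluteGaloisGroup (CyclotomicField p F))) ∧
          IsOpen (χ₂.ker : Set (absoluteGaloisGroup (CyclotomicField p F))) ∧
          ∀ σ, ‖(ρ.restrictField (CyclotomicField p F) σ).val.trace -
            ((χ₁ σ : PadicAlgCl p) + (χ₂ σ : PadicAlgCl p))‖ < 1) →
      (∃ (π₀ : CuspidalAutomorphicRepData 2 F hcpt) (ρ₀ : FramedGaloisRep F (PadicAlgCl p) 2),
          π₀.1.IsLAlgebraic ∧ (∃ T : InfinityType F 2, π₀.1.HasInfinityType T ∧ T.IsRegular) ∧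
          SatakeFrobCompatibleAE ι π₀.1 ρ₀ ∧ ∀ σ, ‖(ρ σ).val.trace - (ρ₀ σ).val.trace‖ < 1) →
      ∃ π : CuspidalAutomorphicRepData 2 F hcpt, π.1.IsLAlgebraic ∧
        (∃ T : InfinityType F 2, π.1.HasInfinityType T ∧ T.IsRegular) ∧
        SatakeFrobCompatibleAE ι π.1 ρ

/-- The conclusion of `HuTan2015_theorem63` is automorphy in the sense of the tree
(`IsAutomorphicAE ι hcpt ρ`, the conclusion of lang.S03 `FontaineMazurLanglandsGLn`) together
with regularity of the infinity type of `π`. [folklore] -/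
theorem HuTan2015_theorem63.isAutomorphicAE (h : HuTan2015_theorem63)
    {F : Type} [Field F] [NumberField F] (hF : IsTotallyReal F) {p : ℕ} [Fact p.Prime]
    (hp : 5 ≤ p) (hdisc : ¬ ((p : ℤ) ∣ NumberField.discr F))
    (hsplit : ∀ v : HeightOneSpectrum (𝓞 F), ((p : ℕ) : 𝓞 F) ∈ v.asIdeal → v.residueCard = p)
    (hcpt : isCompact_glFiniteIntegralLevel 2 F) (ι : PadicAlgCl p ≃+* ℂ)
    (ρ : FramedGaloisRep F (PadicAlgCl p) 2) (hirr : ρ.toGaloisRep.IsIrreducible)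
    (hunr : ∀ᶠ v : HeightOneSpectrum (𝓞 F) in cofinite, ρ.IsUnramifiedAt v) (hodd : ρ.IsOdd)
    (hcrys : ∀ (v : HeightOneSpectrum (𝓞 F)) (hv : ((p : ℕ) : 𝓞 F) ∈ v.asIdeal),
        let D := PAdicHodge.fontainePstAdicCompletion v p hv
        D.IsCrystallineFramed (ρ.toLocal v) ∧
        (letI := D.algebra
         ∀ τ : v.adicCompletion F →ₐ[ℚ_[p]] PadicAlgCl p,
          let M := ρ.labelledHodgeTateWeightsAt v D.algebra D.𝔅 τ.toRingHom
          M.Nodup ∧ Multiset.card M = 2))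
    (hbig : ¬ ∃ χ₁ χ₂ : absoluteGaloisGroup (CyclotomicField p F) →* (PadicAlgCl p)ˣ,
          IsOpen (χ₁.ker : Set (absoluteGaloisGroup (CyclotomicField p F))) ∧
          IsOpen (χ₂.ker : Set (absoluteGaloisGroup (CyclotomicField p F))) ∧
          ∀ σ, ‖(ρ.restrictField (CyclotomicField p F) σ).val.trace -
            ((χ₁ σ : PadicAlgCl p) + (χ₂ σ : PadicAlgCl p))‖ < 1)
    (hmod : ∃ (π₀ : CuspidalAutomorphicRepData 2 F hcpt) (ρ₀ : FramedGaloisRep F (PadicAlgCl p) 2),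
          π₀.1.IsLAlgebraic ∧ (∃ T : InfinityType F 2, π₀.1.HasInfinityType T ∧ T.IsRegular) ∧
          SatakeFrobCompatibleAE ι π₀.1 ρ₀ ∧ ∀ σ, ‖(ρ σ).val.trace - (ρ₀ σ).val.trace‖ < 1) :
    IsAutomorphicAE ι hcpt ρ ∧
      ∃ π : CuspidalAutomorphicRepData 2 F hcpt, π.1.IsLAlgebraic ∧
        (∃ T : InfinityType F 2, π.1.HasInfinityType T ∧ T.IsRegular) ∧
        SatakeFrobCompatibleAE ι π.1 ρ := by
  obtain ⟨π, hL, hreg, hsat⟩ := h F hF p hp hdisc hsplit hcpt ι ρ hirr hunr hodd hcrys hbig hmod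
  exact ⟨⟨π, hL, hsat⟩, π, hL, hreg, hsat⟩

end Literature.NumberTheory.Automorphic

end
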